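import Mathlib
import Literature.Analysis.Complex.PickFunctionsProofs

/-!
# cRPA screening is Löwner-monotone: bare ≥ partially screened ≥ fully screened, and a LARGER
# correlated target space gives a LARGER Hubbard `U` (at fixed one-particle basis)

In the constrained RPA the model ("Hubbard") interaction of a correlated subspace `d` is the bare
Coulomb interaction `v` screened by the REST polarization `P_r = P − P_d`:
`U = W_r = (1 − v P_r)⁻¹ v`, while the fully screened interaction is `W = (1 − vP)⁻¹ v`
[AryasetiawanEtAl2004, §II]; [VaugierJiangBiermann2012, §II].  In a finite (product / auxiliary)
basis and at a fixed frequency these are matrices; in the static limit the RPA polarization pieces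
are NEGATIVE semidefinite and the bare `v` is positive definite (taken here as HYPOTHESES, not
derived).  Writing `(1 − vP)⁻¹ v = (v⁻¹ − P)⁻¹` (`screenMatrix_eq_inv_sub`), every statement
below is the Löwner-order antitonicity of the inverse on positive definite Hermitian matrices
(`Literature.Analysis.Complex.inv_le_inv_of_posDef`, [RosenblumRovnyak1985, Ch. 2 Addenda 2(i)]):

* `posDef_inv_sub` — `v > 0`, `P ≤ 0` ⇒ `v⁻¹ − P > 0` (the screened interaction is well defined
  and positive definite, `screened_posDef`);
* `screened_antitone` — `P₁ ≤ P₂ ≤ 0` ⇒ `(v⁻¹ − P₁)⁻¹ ≤ (v⁻¹ − P₂)⁻¹`: MORE (negative)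
  polarization kept in the screening ⇒ SMALLER interaction, in Löwner order;
* `screened_le_bare` — `(v⁻¹ − P)⁻¹ ≤ v`;
* `fullyScreened_le_partiallyScreened_le_bare` — `P ≤ P_r ≤ 0` ⇒ `W ≤ U ≤ v`: "the interactions
  `U_mm` thus correspond to an intermediate situation between `v_mm` and `W_mm`"
  [VaugierJiangBiermann2012, §IV.A]; diagonal (`U_mm`) and every other quadratic-form reading
  follow from the Löwner statement (`quadForm_mono`);
* `targetSpace_monotone` — **single- vs multi-band target**: if the correlated subspace `d′ ⊇ d`
  removes MORE transitions from the screening (`P_{d′} ≤ P_d`, both pieces of a negative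
  semidefinite `P`), then `U^{(d)} ≤ U^{(d′)}` in Löwner order AT FIXED BASIS `v`.  This is the
  exact kernel of the printed TARGET-SPACE statements (one-band `U_dd = 3.65 eV` vs three-band
  `U_dd = 7.00 eV` for La₂CuO₄ [WernerEtAl2015, §III.A]) — with the caveat, stated there and here,
  that printed one-band and three-band models also use DIFFERENT Wannier functions (bare `v ≈ 20`
  vs `≈ 30 eV`), an effect this file does not address.

* §3 `screened_mono_of_weights_le` — **construction dependence at FIXED bands**: writing the
  static polarization as a finite sum of transition pieces `P = ∑ᵢ Aᵢ`, `Aᵢ ≤ 0`, every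
  "diagonal-weight" cRPA construction removes `∑ᵢ wᵢ Aᵢ` and screens with the rest
  `∑ᵢ (1 − wᵢ) Aᵢ` (`wᵢ = pₙpₙ'`, the product of the target-subspace probabilities of the two
  Bloch states of transition `i`, in the WEIGHTING construction [SasiogluFriedrichBlugel2011,
  p. 3]; `wᵢ ∈ {0,1}` for full exclusion of a band set, or for the spectral construction
  [KaltakEtAl2025, §2.2.3]); POINTWISE-larger removal weights `w ≤ w′ ≤ 1` give a Löwner-larger
  rest polarization (`restPol_mono`) and hence a Löwner-LARGER `U` — the exact kernel of «p-cRPA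
  yields larger effective interactions compared to w-cRPA, because more screening effects are
  removed» [KaltakEtAl2025, §2.2].  SCOPE, stated not proved: two printed constructions
  instantiate the hypothesis only when their weights are pointwise ordered on the SAME transition
  pieces (e.g. weighting vs full exclusion of every transition among bands carrying target weight,
  `prodWeight_le_one`; or any two diagonal constructions on an ISOLATED target, where `pₙ ∈ {0,1}`
  makes the weights coincide, `prodWeight_eq_of_isolated`); the disentanglement construction
  [MiyakeAryasetiawanImada2009] additionally CHANGES the bands, and the projector construction
  keeps off-diagonal projector terms [KaltakEtAl2025, §2.2.2] — neither is a re-weighting of fixed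
  pieces, so the printed one-band cuprate ladder `U^(W) < U^(D)` [NilssonKarlssonAryasetiawan2019,
  §III] is NOT an instance and stays an empirical statement.

* §4 `lever` / `entIndex` — the per-`k` TARGET WEIGHTS (leverage) `pₙ = Σᵢ|⟨ψₙ|wᵢ⟩|²` of the
  Bloch states for orthonormal Wannier targets (`Tᴴ T = 1`): `0 ≤ pₙ ≤ 1` (`lever_le_one`, via the
  idempotent Hermitian projector `T Tᴴ`), trace conservation `Σₙ pₙ = |I|` (`sum_lever_eq_card`)
  [KaltakEtAl2025, §2.2.1–§2.2.3], and the entanglement index `E(W) = Σ_{n∈W} pₙ(1 − pₙ)` of a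
  window: `0 ≤ E`, monotone in the window, `E = |I| − Σpₙ²` on the full set with the
  Cauchy–Schwarz ceiling `|I|(1 − |I|/|S|)`, and `E(W) = 0 ↔` all `pₙ ∈ {0,1}` on `W` — the
  isolated case in which every diagonal construction carries the same weights (§3).

Not here: the RPA formula for `P` and its sign (hypothesis `P ≤ 0`, `Aᵢ ≤ 0`), frequency
dependence, the basis (Wannier-spread) dependence of `v`, local-field details.  No facts, no
axioms beyond Mathlib's.

References: F. Aryasetiawan, M. Imada, A. Georges, G. Kotliar, S. Biermann, A. I. Lichtenstein,
Phys. Rev. B 70 (2004) 195104, §II · L. Vaugier, H. Jiang, S. Biermann, Phys. Rev. B 86 (2012)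
165105, §II, §IV.A · P. Werner, R. Sakuma, F. Nilsson, F. Aryasetiawan, Phys. Rev. B 91 (2015)
125142, §III.A · M. Rosenblum, J. Rovnyak, *Hardy classes and operator theory* (1985), Ch. 2 ·
E. Şaşıoğlu, C. Friedrich, S. Blügel, Phys. Rev. B 83 (2011) 121101(R), p. 3 · M. Kaltak, A. Hampel,
M. Schlipf, I. R. Reddy, B. Kim, G. Kresse, Phys. Rev. B (2025) doi:10.1103/m3gh-g6r6
(arXiv:2508.15368), §2.2 · T. Miyake, F. Aryasetiawan, M. Imada, Phys. Rev. B 80 (2009) 155134 ·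
F. Nilsson, K. Karlsson, F. Aryasetiawan, Phys. Rev. B 99 (2019) 075135, §III.
AI-produced formalisation (H21, cell hubbard-downfold, seat lit-1, 2026-08-27; §3 and §4 appended same day).
-/

noncomputable section

open scoped ComplexOrder MatrixOrder Matrix.Norms.L2Operator

namespace Literature.MathematicalPhysics.QuantumLattice

namespace CRPAScreening

open Matrix

variable {n : ℕ}

/-- Finite-basis identity `(1 − vP)⁻¹ v = (v⁻¹ − P)⁻¹` for invertible `v` (Mathlib's nonsingular
inverse on both sides; no invertibility of `1 − vP` is needed for the identity of generalized
inverses). [cite: AryasetiawanEtAl2004, §II (`W_r = (1 − vP_r)⁻¹ v`)] -/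
theorem screenMatrix_eq_inv_sub (v P : Matrix (Fin n) (Fin n) ℂ) (hv : IsUnit v.det) :
    (1 - v * P)⁻¹ * v = (v⁻¹ - P)⁻¹ := by
  have h1 : 1 - v * P = v * (v⁻¹ - P) := by
    rw [Matrix.mul_sub, Matrix.mul_nonsing_inv _ hv]
  rw [h1, Matrix.mul_inv_rev, Matrix.mul_assoc, Matrix.nonsing_inv_mul _ hv, Matrix.mul_one]

/-- `v > 0` and `P ≤ 0` (Löwner) ⇒ `v⁻¹ − P` is positive definite. [cite: AryasetiawanEtAl2004, §II] -/
theorem posDef_inv_sub {v P : Matrix (Fin n) (Fin n) ℂ} (hv : v.PosDef) (hP : P ≤ 0) :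
    (v⁻¹ - P).PosDef := by
  have h0 : (0 - P).PosSemidef := Matrix.le_iff.mp hP
  rw [zero_sub] at h0
  rw [sub_eq_add_neg]
  exact hv.inv.add_posSemidef h0

/-- Hence the screened interaction `(v⁻¹ − P)⁻¹` is positive definite. [cite: AryasetiawanEtAl2004,
§II] -/
theorem screened_posDef {v P : Matrix (Fin n) (Fin n) ℂ} (hv : v.PosDef) (hP : P ≤ 0) :
    ((v⁻¹ - P)⁻¹).PosDef :=
  (posDef_inv_sub hv hP).inv

/-- **Screening is Löwner-antitone in the polarization**: `v > 0`, `P₁ ≤ P₂ ≤ 0` ⇒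
`(v⁻¹ − P₁)⁻¹ ≤ (v⁻¹ − P₂)⁻¹` — keeping more (negative) polarization in the screening lowers the
interaction. [cite: VaugierJiangBiermann2012, §IV.A]; [cite: RosenblumRovnyak1985, Ch. 2 Addenda
2(i) (antitonicity of the inverse)] -/
theorem screened_antitone {v P₁ P₂ : Matrix (Fin n) (Fin n) ℂ} (hv : v.PosDef) (h12 : P₁ ≤ P₂)
    (h2 : P₂ ≤ 0) : (v⁻¹ - P₁)⁻¹ ≤ (v⁻¹ - P₂)⁻¹ := by
  apply Literature.Analysis.Complex.inv_le_inv_of_posDef (posDef_inv_sub hv h2)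
  rw [Matrix.le_iff] at h12 ⊢
  have e : v⁻¹ - P₁ - (v⁻¹ - P₂) = P₂ - P₁ := by abel
  rw [e]
  exact h12

/-- **Screened ≤ bare**: `v > 0`, `P ≤ 0` ⇒ `(v⁻¹ − P)⁻¹ ≤ v`. [cite: VaugierJiangBiermann2012,
§IV.A] -/
theorem screened_le_bare {v P : Matrix (Fin n) (Fin n) ℂ} (hv : v.PosDef) (hP : P ≤ 0) :
    (v⁻¹ - P)⁻¹ ≤ v := by
  have hvu : IsUnit v.det := (Matrix.isUnit_iff_isUnit_det v).mp hv.isUnit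
  have hle : v⁻¹ ≤ v⁻¹ - P := by
    rw [Matrix.le_iff]
    have e : v⁻¹ - P - v⁻¹ = 0 - P := by abel
    rw [e]
    exact Matrix.le_iff.mp hP
  have h := Literature.Analysis.Complex.inv_le_inv_of_posDef hv.inv hle
  rwa [Matrix.nonsing_inv_nonsing_inv v hvu] at h

/-- **`W ≤ U ≤ v`**: with total polarization `P` and rest polarization `P_r` satisfying
`P ≤ P_r ≤ 0` (the constrained polarization omits some negative-semidefinite transition terms),
the fully screened `W = (v⁻¹ − P)⁻¹`, the cRPA `U = (v⁻¹ − P_r)⁻¹` and the bare `v` are ordered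
`W ≤ U ≤ v` ("`U_mm` … an intermediate situation between `v_mm` and `W_mm`").
[cite: VaugierJiangBiermann2012, §IV.A]; [cite: AryasetiawanEtAl2004, §II] -/
theorem fullyScreened_le_partiallyScreened_le_bare {v P Pr : Matrix (Fin n) (Fin n) ℂ}
    (hv : v.PosDef) (hPPr : P ≤ Pr) (hPr : Pr ≤ 0) :
    (v⁻¹ - P)⁻¹ ≤ (v⁻¹ - Pr)⁻¹ ∧ (v⁻¹ - Pr)⁻¹ ≤ v :=
  ⟨screened_antitone hv hPPr hPr, screened_le_bare hv hPr⟩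

/-- **TARGET-SPACE MONOTONICITY (single- vs multi-band)** at fixed basis: let `P` be the total
polarization and `P_d`, `P_{d′}` the parts generated inside two correlated subspaces with `d′`
removing more transitions than `d` (`P_{d′} ≤ P_d`), and suppose the rest polarization of the
larger target is still non-positive (`P − P_{d′} ≤ 0`).  Then the cRPA interactions
`U^{(d)} = (v⁻¹ − (P − P_d))⁻¹` and `U^{(d′)} = (v⁻¹ − (P − P_{d′}))⁻¹` satisfy
`U^{(d)} ≤ U^{(d′)}` — fewer screening channels, larger `U` (one-band target `U_dd` 3.65 eV <
three-band target 7.00 eV in La₂CuO₄, where in addition the Wannier bases differ).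
[cite: WernerEtAl2015, §III.A]; [cite: VaugierJiangBiermann2012, §IV.A–B (d–dp vs t₂g–t₂g
models)]; [cite: AryasetiawanEtAl2004, §II] -/
theorem targetSpace_monotone {v P Pd Pd' : Matrix (Fin n) (Fin n) ℂ} (hv : v.PosDef)
    (hnest : Pd' ≤ Pd) (hrest : P - Pd' ≤ 0) :
    (v⁻¹ - (P - Pd))⁻¹ ≤ (v⁻¹ - (P - Pd'))⁻¹ := by
  apply screened_antitone hv _ hrest
  rw [Matrix.le_iff] at hnest ⊢
  have e : P - Pd' - (P - Pd) = Pd - Pd' := by abel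
  rw [e]
  exact hnest

/-- Reading a Löwner inequality on any vector (e.g. a basis vector ⇒ the diagonal `U_mm ≤ v_mm`):
`A ≤ B` ⇒ `re ⟪x, A x⟫ ≤ re ⟪x, B x⟫`. [cite: VaugierJiangBiermann2012, §IV.A (`U_mm` between
`v_mm` and `W_mm`)] -/
theorem quadForm_mono {A B : Matrix (Fin n) (Fin n) ℂ} (hAB : A ≤ B) (x : Fin n → ℂ) :
    (star x ⬝ᵥ (A *ᵥ x)).re ≤ (star x ⬝ᵥ (B *ᵥ x)).re := by
  have h := (Matrix.le_iff.mp hAB).dotProduct_mulVec_nonneg x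
  rw [Matrix.sub_mulVec, dotProduct_sub] at h
  have hre := (Complex.nonneg_iff.mp h).1
  rw [Complex.sub_re] at hre
  linarith

/-! ## §3 Construction dependence at FIXED bands: weighted removal of transition pieces

The total static polarization is a finite sum of transition contributions `P = ∑ i ∈ s, A i`,
each `A i ≤ 0` (hypothesis).  A "diagonal-weight" cRPA construction removes `∑ wᵢ • Aᵢ` and keeps
the REST `∑ (1 − wᵢ) • Aᵢ` in the screening, `wᵢ ≤ 1`.  Weights are real; they enter the complex
matrices through the coercion `ℝ → ℂ`. -/

section Weights

variable {ι : Type*}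

/-- A non-positive piece scaled by a non-negative real stays non-positive (Löwner).
[cite: VaugierJiangBiermann2012, §IV.A (sign of the polarization pieces)] -/
theorem real_smul_nonpos {A : Matrix (Fin n) (Fin n) ℂ} (hA : A ≤ 0) {c : ℝ} (hc : 0 ≤ c) :
    ((c : ℂ) • A) ≤ 0 := by
  rw [Matrix.le_iff] at hA ⊢
  rw [zero_sub] at hA ⊢
  rw [← smul_neg]
  exact hA.smul (Complex.zero_le_real.mpr hc)

/-- Sums of non-positive transition pieces with non-negative real coefficients are non-positive.
[cite: SasiogluFriedrichBlugel2011, p. 3 (`P_d` = Lehmann sum of transitions weighted by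
probabilities)] -/
theorem sum_real_smul_nonpos (s : Finset ι) (A : ι → Matrix (Fin n) (Fin n) ℂ) (c : ι → ℝ)
    (hA : ∀ i ∈ s, A i ≤ 0) (hc : ∀ i ∈ s, 0 ≤ c i) :
    ∑ i ∈ s, ((c i : ℂ) • A i) ≤ 0 := by
  classical
  induction s using Finset.induction_on with
  | empty => simp
  | insert a s ha ih =>
    rw [Finset.sum_insert ha]
    have h1 : ((c a : ℂ) • A a) ≤ 0 :=
      real_smul_nonpos (hA a (Finset.mem_insert_self a s)) (hc a (Finset.mem_insert_self a s))
    have h2 : ∑ i ∈ s, ((c i : ℂ) • A i) ≤ 0 :=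
      ih (fun i hi => hA i (Finset.mem_insert_of_mem hi))
        (fun i hi => hc i (Finset.mem_insert_of_mem hi))
    simpa using add_le_add h1 h2

/-- The REST polarization of a diagonal-weight construction, `∑ (1 − wᵢ) • Aᵢ`, is non-positive
whenever the removal weights satisfy `wᵢ ≤ 1` (so `screened_posDef` / `screened_antitone` apply).
[cite: SasiogluFriedrichBlugel2011, p. 3 (probabilities `p_{km} p_{k+q m′} ≤ 1`)];
[cite: KaltakEtAl2025, §2.2.1 («the leverage is a positive number between 0 and 1»)] -/
theorem restPol_nonpos (s : Finset ι) (A : ι → Matrix (Fin n) (Fin n) ℂ) (w : ι → ℝ)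
    (hA : ∀ i ∈ s, A i ≤ 0) (hw1 : ∀ i ∈ s, w i ≤ 1) :
    ∑ i ∈ s, (((1 - w i : ℝ) : ℂ) • A i) ≤ 0 :=
  sum_real_smul_nonpos s A (fun i => 1 - w i) hA (fun i hi => sub_nonneg.mpr (hw1 i hi))

/-- **More weight removed ⇒ Löwner-larger (less negative) rest polarization**: pointwise
`w ≤ w′` on the same transition pieces `Aᵢ ≤ 0` gives `∑ (1 − wᵢ) Aᵢ ≤ ∑ (1 − w′ᵢ) Aᵢ`.
[cite: KaltakEtAl2025, §2.2 («p-cRPA … removes more screening effects»; §2.2.1 «off-diagonal terms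
… are not removed … in w-cRPA»)] -/
theorem restPol_mono (s : Finset ι) (A : ι → Matrix (Fin n) (Fin n) ℂ) (w w' : ι → ℝ)
    (hA : ∀ i ∈ s, A i ≤ 0) (hww' : ∀ i ∈ s, w i ≤ w' i) :
    ∑ i ∈ s, (((1 - w i : ℝ) : ℂ) • A i) ≤ ∑ i ∈ s, (((1 - w' i : ℝ) : ℂ) • A i) := by
  have h := sum_real_smul_nonpos s A (fun i => w' i - w i) hA
    (fun i hi => sub_nonneg.mpr (hww' i hi))
  rw [Matrix.le_iff, zero_sub] at h
  rw [Matrix.le_iff]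
  have e : ∑ i ∈ s, (((1 - w' i : ℝ) : ℂ) • A i) - ∑ i ∈ s, (((1 - w i : ℝ) : ℂ) • A i)
      = -∑ i ∈ s, (((w' i - w i : ℝ) : ℂ) • A i) := by
    rw [← Finset.sum_sub_distrib, ← Finset.sum_neg_distrib]
    refine Finset.sum_congr rfl ?_
    intro i _
    rw [← sub_smul, ← neg_smul]
    congr 1
    push_cast
    ring
  rw [e]
  exact h

/-- **WEIGHTED-REMOVAL MONOTONICITY OF THE cRPA `U` (construction dependence at fixed bands)**:
for a positive definite bare `v`, transition pieces `Aᵢ ≤ 0` and two diagonal-weight constructions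
with pointwise ordered removal weights `w ≤ w′ ≤ 1` on the same pieces, the screened interactions
`U(w) = (v⁻¹ − ∑ (1 − wᵢ) Aᵢ)⁻¹` satisfy `U(w) ≤ U(w′)` in Löwner order — removing more of the
target's screening RAISES `U`.  Printed instance of the sentence (not of the hypothesis in general,
see the module docstring): «Typically, p-cRPA yields larger effective interactions compared to
w-cRPA, because more screening effects are removed». [cite: KaltakEtAl2025, §2.2];
[cite: SasiogluFriedrichBlugel2011, p. 3]; [cite: AryasetiawanEtAl2004, §II] -/
theorem screened_mono_of_weights_le {v : Matrix (Fin n) (Fin n) ℂ} (hv : v.PosDef) (s : Finset ι)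
    (A : ι → Matrix (Fin n) (Fin n) ℂ) (w w' : ι → ℝ) (hA : ∀ i ∈ s, A i ≤ 0)
    (hww' : ∀ i ∈ s, w i ≤ w' i) (hw'1 : ∀ i ∈ s, w' i ≤ 1) :
    (v⁻¹ - ∑ i ∈ s, (((1 - w i : ℝ) : ℂ) • A i))⁻¹
      ≤ (v⁻¹ - ∑ i ∈ s, (((1 - w' i : ℝ) : ℂ) • A i))⁻¹ :=
  screened_antitone hv (restPol_mono s A w w' hA hww') (restPol_nonpos s A w' hA hw'1)

/-- Full removal of every piece (`w′ ≡ 1`) leaves no rest screening: `U(1) = v`, the bare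
interaction — the top of the ladder `U(w) ≤ v` (`screened_le_bare`). [cite: AryasetiawanEtAl2004,
§II (`P_r = 0 ⇒ W_r = v`)] -/
theorem screened_weights_one_eq_bare {v : Matrix (Fin n) (Fin n) ℂ} (hv : v.PosDef) (s : Finset ι)
    (A : ι → Matrix (Fin n) (Fin n) ℂ) :
    (v⁻¹ - ∑ i ∈ s, (((1 - (1 : ℝ) : ℝ) : ℂ) • A i))⁻¹ = v := by
  have hvu : IsUnit v.det := (Matrix.isUnit_iff_isUnit_det v).mp hv.isUnit
  simp [Matrix.nonsing_inv_nonsing_inv v hvu]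

/-- The WEIGHTING construction's removal weight of a transition is the product of the two states'
target-subspace probabilities; with `0 ≤ p, q ≤ 1` it lies in `[0, 1]` and is dominated by each
factor — so it is pointwise below full exclusion (`weight 1`) of every transition whose states carry
any target weight. [cite: SasiogluFriedrichBlugel2011, p. 3 (`p_{km} p_{k+q m′}` «as the
probability for the transition itself»)] -/
theorem prodWeight_le_one {p q : ℝ} (hp0 : 0 ≤ p) (hp1 : p ≤ 1) (hq0 : 0 ≤ q) (hq1 : q ≤ 1) :
    0 ≤ p * q ∧ p * q ≤ 1 ∧ p * q ≤ p ∧ p * q ≤ q := by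
  refine ⟨mul_nonneg hp0 hq0, ?_, ?_, ?_⟩
  · nlinarith
  · nlinarith
  · nlinarith

/-- ISOLATED target: when every probability is `0` or `1` the product weight IS the indicator of
"both states in the target", i.e. the weighting construction coincides with plain exclusion of the
target bands (and with any other diagonal construction) — the entangled case is where they differ.
[cite: SasiogluFriedrichBlugel2011, p. 3 («no unique identification of the d-d transitions» only
for ENTANGLED bands)]; [cite: KaltakEtAl2025, §2.2.2 («the original projector … has a discrete
spectrum Θ ∈ {0,1}»)] -/
theorem prodWeight_eq_of_isolated {p q : ℝ} (hp : p = 0 ∨ p = 1) (hq : q = 0 ∨ q = 1) :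
    p * q = if p = 1 ∧ q = 1 then 1 else 0 := by
  rcases hp with rfl | rfl <;> rcases hq with rfl | rfl <;> norm_num

end Weights

/-! ## §4 Target weights (leverage) per Bloch state at fixed `k`, their trace, and the
entanglement index `Σₙ pₙ(1 − pₙ)` that separates the constructions

At one `k`-point let `T : Matrix S I ℂ`, `T n i = ⟨ψₙ|wᵢ⟩`, map the Bloch states `n ∈ S` of the
window onto ORTHONORMAL Wannier targets `i ∈ I` (`Tᴴ T = 1`).  The target weight («leverage») of
state `n` is `pₙ = P_nn = Σᵢ |T n i|²`, the diagonal of the correlated projector `P = T Tᴴ`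
[KaltakEtAl2025, §2.2.1–§2.2.3 («the leverage is a positive number between 0 and 1»; w-cRPA
«conserves the number of electrons»; the s-cRPA «trace … is conserved»)].  Exact content:
`0 ≤ pₙ ≤ 1`, `Σₙ pₙ = |I|` (trace conservation), and for the index
`E = Σₙ pₙ(1 − pₙ)` (the in-house «entanglement-at-E_F census» summand): `0 ≤ E`,
`E = |I| − Σₙ pₙ²`, `E ≤ |I|(1 − |I|/|S|)` (Cauchy–Schwarz: weight spread evenly is the most
entangled), and `E = 0 ↔ every pₙ ∈ {0, 1}` — exactly the ISOLATED case in which the weighting,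
selection and exclusion constructions carry the same transition weights (`prodWeight_eq_of_isolated`).
-/

section Leverage

variable {S I : Type*} [Fintype S] [Fintype I] [DecidableEq I]

/-- Target weight («leverage») of Bloch state `n`: `pₙ = Σᵢ |⟨ψₙ|wᵢ⟩|² = (T Tᴴ)ₙₙ`.
[cite: KaltakEtAl2025, §2.2.1] -/
def lever (T : Matrix S I ℂ) (n : S) : ℝ := ∑ i, Complex.normSq (T n i)

/-- The entanglement index of a set `W` of Bloch states (a window) at one `k`:
`E(W) = Σ_{n ∈ W} pₙ (1 − pₙ)`. [cite: KaltakEtAl2025, §2.2.1 (w-cRPA keeps the `(1 − p)` shares)] -/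
def entIndex (T : Matrix S I ℂ) (W : Finset S) : ℝ := ∑ n ∈ W, lever T n * (1 - lever T n)

omit [Fintype S] [DecidableEq I] in
/-- [cite: KaltakEtAl2025, §2.2.1] Unfolding lemma. -/
theorem lever_def (T : Matrix S I ℂ) (n : S) : lever T n = ∑ i, Complex.normSq (T n i) := rfl

omit [Fintype S] [DecidableEq I] in
/-- [cite: KaltakEtAl2025, §2.2.1] Unfolding lemma. -/
theorem entIndex_def (T : Matrix S I ℂ) (W : Finset S) :
    entIndex T W = ∑ n ∈ W, lever T n * (1 - lever T n) := rfl

omit [Fintype S] [DecidableEq I] in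
/-- [cite: KaltakEtAl2025, §2.2.1] `pₙ ≥ 0`. -/
theorem lever_nonneg (T : Matrix S I ℂ) (n : S) : 0 ≤ lever T n :=
  Finset.sum_nonneg fun _ _ => Complex.normSq_nonneg _

omit [Fintype S] [DecidableEq I] in
/-- [cite: KaltakEtAl2025, §2.2.2 (`P_nm = Σ_{i∈C} T*_in T_im`)] The leverage is the diagonal of
the correlated projector: `((T Tᴴ) n n : ℂ) = pₙ`. -/
theorem proj_diag_eq_lever (T : Matrix S I ℂ) (n : S) :
    (T * Tᴴ) n n = (lever T n : ℂ) := by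
  unfold lever
  simp only [Matrix.mul_apply, Matrix.conjTranspose_apply, Complex.ofReal_sum]
  refine Finset.sum_congr rfl fun i _ => ?_
  rw [Complex.star_def, Complex.mul_conj]

/-- **Trace conservation** [cite: KaltakEtAl2025, §2.2.1 («w-cRPA conserves the number of
electrons»), §2.2.3 («the trace … is conserved»)]: for orthonormal targets (`Tᴴ T = 1`) the
leverages at one `k` sum to the number of targets, `Σₙ pₙ = |I|`. -/
theorem sum_lever_eq_card (T : Matrix S I ℂ) (hT : Tᴴ * T = 1) :
    ∑ n, lever T n = Fintype.card I := by
  have h : ((∑ n, lever T n : ℝ) : ℂ) = (Fintype.card I : ℂ) := by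
    rw [Complex.ofReal_sum]
    have : ∑ n, (lever T n : ℂ) = Matrix.trace (T * Tᴴ) := by
      simp only [Matrix.trace, Matrix.diag, proj_diag_eq_lever]
    rw [this, Matrix.trace_mul_comm, hT, Matrix.trace_one]
  exact_mod_cast h

/-- Hermiticity and idempotency of the correlated projector `P = T Tᴴ` for orthonormal targets.
[cite: KaltakEtAl2025, §2.2.2 («the original projector … has a discrete spectrum Θ ∈ {0,1}»)] -/
theorem proj_idem (T : Matrix S I ℂ) (hT : Tᴴ * T = 1) :
    (T * Tᴴ)ᴴ = T * Tᴴ ∧ T * Tᴴ * (T * Tᴴ) = T * Tᴴ := by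
  constructor
  · rw [Matrix.conjTranspose_mul, Matrix.conjTranspose_conjTranspose]
  · calc T * Tᴴ * (T * Tᴴ) = T * (Tᴴ * T) * Tᴴ := by simp only [Matrix.mul_assoc]
      _ = T * Tᴴ := by rw [hT, Matrix.mul_one]

/-- [cite: KaltakEtAl2025, §2.2.1 («the leverage is a positive number between 0 and 1»)]
`pₙ = Σₘ |P_nm|²` for the idempotent Hermitian `P = T Tᴴ` — hence `pₙ² ≤ pₙ`. -/
theorem lever_eq_sum_normSq_proj (T : Matrix S I ℂ) (hT : Tᴴ * T = 1) (n : S) :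
    lever T n = ∑ m, Complex.normSq ((T * Tᴴ) n m) := by
  obtain ⟨hH, hP⟩ := proj_idem T hT
  have h1 : ((T * Tᴴ) * (T * Tᴴ)) n n = (lever T n : ℂ) := by rw [hP, proj_diag_eq_lever]
  have h2 : ((T * Tᴴ) * (T * Tᴴ)) n n = ∑ m, (Complex.normSq ((T * Tᴴ) n m) : ℂ) := by
    rw [Matrix.mul_apply]
    refine Finset.sum_congr rfl fun m _ => ?_
    have hm : (T * Tᴴ) m n = star ((T * Tᴴ) n m) := by
      rw [← Matrix.conjTranspose_apply, hH]
    rw [hm, Complex.star_def, Complex.mul_conj]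
  have h : (lever T n : ℂ) = ((∑ m, Complex.normSq ((T * Tᴴ) n m) : ℝ) : ℂ) := by
    rw [← h1, h2, Complex.ofReal_sum]
  exact_mod_cast h

/-- [cite: KaltakEtAl2025, §2.2.1] `pₙ² ≤ pₙ`. -/
theorem lever_sq_le (T : Matrix S I ℂ) (hT : Tᴴ * T = 1) (n : S) :
    lever T n ^ 2 ≤ lever T n := by
  have h := lever_eq_sum_normSq_proj T hT n
  have hnn : Complex.normSq ((T * Tᴴ) n n) = lever T n ^ 2 := by
    rw [proj_diag_eq_lever, Complex.normSq_ofReal, sq]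
  calc lever T n ^ 2 = Complex.normSq ((T * Tᴴ) n n) := hnn.symm
    _ ≤ ∑ m, Complex.normSq ((T * Tᴴ) n m) :=
        Finset.single_le_sum (fun m _ => Complex.normSq_nonneg _) (Finset.mem_univ n)
    _ = lever T n := h.symm

/-- **`0 ≤ pₙ ≤ 1`** for orthonormal targets. [cite: KaltakEtAl2025, §2.2.1 («the leverage is a
positive number between 0 and 1»)] -/
theorem lever_le_one (T : Matrix S I ℂ) (hT : Tᴴ * T = 1) (n : S) : lever T n ≤ 1 := by
  have h0 := lever_nonneg T n
  have h2 := lever_sq_le T hT n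
  nlinarith [h0, h2]

/-- [cite: KaltakEtAl2025, §2.2.1] Each census summand is non-negative: `0 ≤ pₙ(1 − pₙ)`. -/
theorem lever_mul_one_sub_nonneg (T : Matrix S I ℂ) (hT : Tᴴ * T = 1) (n : S) :
    0 ≤ lever T n * (1 - lever T n) :=
  mul_nonneg (lever_nonneg T n) (sub_nonneg.mpr (lever_le_one T hT n))

/-- [cite: KaltakEtAl2025, §2.2.1] The entanglement index of any window is non-negative. -/
theorem entIndex_nonneg (T : Matrix S I ℂ) (hT : Tᴴ * T = 1) (W : Finset S) :
    0 ≤ entIndex T W :=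
  Finset.sum_nonneg fun n _ => lever_mul_one_sub_nonneg T hT n

/-- [cite: KaltakEtAl2025, §2.2.1] Enlarging the window can only raise the index (every summand is
non-negative): `W ⊆ W′ ⇒ E(W) ≤ E(W′)`. -/
theorem entIndex_mono (T : Matrix S I ℂ) (hT : Tᴴ * T = 1) {W W' : Finset S} (h : W ⊆ W') :
    entIndex T W ≤ entIndex T W' :=
  Finset.sum_le_sum_of_subset_of_nonneg h fun n _ _ => lever_mul_one_sub_nonneg T hT n

omit [Fintype S] [DecidableEq I] in
/-- [cite: KaltakEtAl2025, §2.2.1] `E(W) = Σ_{n∈W} pₙ − Σ_{n∈W} pₙ²`. -/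
theorem entIndex_eq (T : Matrix S I ℂ) (W : Finset S) :
    entIndex T W = ∑ n ∈ W, lever T n - ∑ n ∈ W, lever T n ^ 2 := by
  unfold entIndex
  rw [← Finset.sum_sub_distrib]
  refine Finset.sum_congr rfl fun n _ => ?_
  ring

/-- [cite: KaltakEtAl2025, §2.2.1 + §2.2.3 (trace conservation)] Over the FULL state set the index
is `|I| − Σₙ pₙ²`. -/
theorem entIndex_univ (T : Matrix S I ℂ) (hT : Tᴴ * T = 1) :
    entIndex T Finset.univ = Fintype.card I - ∑ n, lever T n ^ 2 := by
  rw [entIndex_eq, sum_lever_eq_card T hT]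

/-- **Cauchy–Schwarz ceiling** [cite: KaltakEtAl2025, §2.2.1]: over the full set of `|S|` states,
`E ≤ |I| (1 − |I|/|S|)` — target weight spread EVENLY over the window is the most entangled case. -/
theorem entIndex_univ_le (T : Matrix S I ℂ) (hT : Tᴴ * T = 1) (hS : 0 < Fintype.card S) :
    entIndex T Finset.univ ≤ Fintype.card I * (1 - Fintype.card I / (Fintype.card S : ℝ)) := by
  rw [entIndex_univ T hT]
  -- (Σ p)² ≤ |S| Σ p²
  have hcs : (∑ n, lever T n) ^ 2 ≤ Fintype.card S * ∑ n, lever T n ^ 2 := by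
    have h2 := Finset.sum_mul_sq_le_sq_mul_sq Finset.univ (fun n => lever T n) (fun _ => (1 : ℝ))
    simp only [mul_one, one_pow, Finset.sum_const, Finset.card_univ, nsmul_eq_mul] at h2
    linarith
  have hsum := sum_lever_eq_card T hT
  rw [hsum] at hcs
  have hS' : (0 : ℝ) < Fintype.card S := by exact_mod_cast hS
  -- |I|² ≤ |S| Σp²  ⇒  Σp² ≥ |I|²/|S|
  have : (Fintype.card I : ℝ) ^ 2 / Fintype.card S ≤ ∑ n, lever T n ^ 2 := by
    rw [div_le_iff₀ hS']
    linarith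
  have e : (Fintype.card I : ℝ) * (1 - Fintype.card I / (Fintype.card S : ℝ))
      = Fintype.card I - (Fintype.card I : ℝ) ^ 2 / Fintype.card S := by ring
  rw [e]
  linarith

/-- **`E(W) = 0 ↔` every state of the window has binary target weight** (`pₙ ∈ {0,1}`) — the
ISOLATED situation in which the weighting, selection and exclusion constructions assign the same
transition weights (`prodWeight_eq_of_isolated`); any `0 < pₙ < 1` in the window makes `E > 0`.
[cite: KaltakEtAl2025, §2.2.2 («discrete spectrum Θ ∈ {0,1}» for an isolated target)];
[cite: SasiogluFriedrichBlugel2011, p. 3] -/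
theorem entIndex_eq_zero_iff (T : Matrix S I ℂ) (hT : Tᴴ * T = 1) (W : Finset S) :
    entIndex T W = 0 ↔ ∀ n ∈ W, lever T n = 0 ∨ lever T n = 1 := by
  unfold entIndex
  rw [Finset.sum_eq_zero_iff_of_nonneg (fun n _ => lever_mul_one_sub_nonneg T hT n)]
  refine forall₂_congr fun n _ => ?_
  rw [mul_eq_zero, sub_eq_zero]
  exact or_congr Iff.rfl eq_comm

end Leverage

end CRPAScreening

end Literature.MathematicalPhysics.QuantumLattice
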